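import Mathlib
import Literature.Analysis.FluidPDE.VectorCalculus
import Summits.NavierStokesRegularity.NavierStokesRegularity.Theorems.SlicedKelvinPlanarFluxAPrioriApexPointwise
import Summits.NavierStokesRegularity.NavierStokesRegularity.Theorems.SlicedKelvinPlanarFluxAPrioriApexSlab

/-!
# Crux `SlicedKelvin.PlanarFluxAPriori` (stmt-NavierStokesRegularity-15600), line `Sketch`:
  STUB `stub_apexLipschitz` (the half-space apex identity, Lipschitz form)

Lands `--supports stmt-NavierStokesRegularity-15600` the registered stub `stub_apexLipschitz` of
the lead's skeleton `Cruxes/PlanarFluxAPriori/Lines/Sketch.lean` (card `halfspace-apex-identity`).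
For a smooth field `v : ℝ³ → ℝ³` whose derivatives of orders `≤ 3` decay like `(1 + ‖x‖)⁻³`, a
frame `R` (normal `n = R e₂`, planes `Π_c = R{x₂ = c}` charted by `y ↦ R (y₀, y₁, c)`),
`ω = curl v`, `f = ⟪ω, n⟫`, `q = Df[ω]` and `ε > 0`:

  `∫_{Π_c} f²/√(f²+ε²) ≤ ∫_{Π_{c'}} f²/√(f²+ε²) + ∫_{⟪x,n⟫ ∈ [c ⊓ c', c ⊔ c']} (ε²/√(f²+ε²)³) |q|`.

Proof (divergence theorem on the slab for the field `H(f) ω`, `H(s) = s/√(s² + ε²)`, organised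
as a fundamental theorem of calculus in the height):
1. `g(s) = ∫_{Π_s} f²/√(f²+ε²)` has derivative `φ(s) = ∫_{Π_s} H'(f) q` at every height
   (`apexLipschitz_hasDerivAt_planeIntegral` of `…ApexPointwise`: differentiation under the
   integral, the pointwise identity `div (H(f) ω) = H'(f) q` from `div curl v = 0`, and the
   vanishing of in-plane divergences over the plane);
2. the density `Q = H'(f)|q|` is integrable on `ℝ³` (`apexLipschitz_integrable_density`), hence so
   is the signed density `H'(f) q` (`|H'(f) q| = Q`), and by Fubini along the measure-preserving
   foliation chart the plane integrals `φ` and `ψ(s) = ∫_{Π_s} Q` are integrable in the height and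
   `∫_{slab} Q = ∫_{[c ⊓ c', c ⊔ c']} ψ` (`apexLipschitz_setIntegral_slab_eq` of `…ApexSlab`);
3. `g(c) − g(c') = ∫_{c'}^{c} φ ≤ ∫_{[c ⊓ c', c ⊔ c']} |φ| ≤ ∫_{[c ⊓ c', c ⊔ c']} ψ`
   (`apexLipschitz_le_add_setIntegral_of_hasDerivAt`, `|φ| ≤ ψ` by `‖∫ ·‖ ≤ ∫ ‖·‖`).
-/

noncomputable section

namespace Summit.NavierStokesRegularity.NavierStokesRegularity.Theorems.SlicedKelvinPlanarFluxAPriori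

set_option linter.dupNamespace false
-- the summit and its single sub-problem share the name (CONVENTIONS §1)

open MeasureTheory
open Literature.Analysis.FluidPDE
open scoped InnerProductSpace RealInnerProductSpace ContDiff

/-- **STUB `stub_apexLipschitz`** of the `Sketch` skeleton of `SlicedKelvin.PlanarFluxAPriori`
(registered signature, verbatim): the half-space apex identity in Lipschitz form. For a smooth
field `v` with cubic decay of its derivatives of orders `≤ 3`, a frame `R` (`n = R e₂`),
`f = ⟪curl v, n⟫`, `q = Df[curl v]` and `ε > 0`,
`∫_{Π_c} f²/√(f²+ε²) ≤ ∫_{Π_{c'}} f²/√(f²+ε²) + ∫_{⟪x,n⟫ ∈ [c ⊓ c', c ⊔ c']} (ε²/√(f²+ε²)³)|q|`. -/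
theorem stub_apexLipschitz :
    ∀ (ε : ℝ), 0 < ε → ∀ (R : EuclideanSpace ℝ (Fin 3) ≃ₗᵢ[ℝ] EuclideanSpace ℝ (Fin 3)) (c c' : ℝ)
      (v : EuclideanSpace ℝ (Fin 3) → EuclideanSpace ℝ (Fin 3)), ContDiff ℝ (⊤ : ℕ∞) v →
      (∃ C : ℝ, ∀ (x : EuclideanSpace ℝ (Fin 3)) (k : ℕ), k ≤ 3 →
        (1 + ‖x‖) ^ 3 * ‖iteratedFDeriv ℝ k v x‖ ≤ C) →
      ∫ y : EuclideanSpace ℝ (Fin 2), inner ℝ (Literature.Analysis.FluidPDE.curl v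
          (R (WithLp.toLp 2 ![y 0, y 1, c]))) (R (EuclideanSpace.single 2 1)) ^ 2 /
          Real.sqrt (inner ℝ (Literature.Analysis.FluidPDE.curl v (R (WithLp.toLp 2 ![y 0, y 1, c])))
            (R (EuclideanSpace.single 2 1)) ^ 2 + ε ^ 2) ≤
      (∫ y : EuclideanSpace ℝ (Fin 2), inner ℝ (Literature.Analysis.FluidPDE.curl v
          (R (WithLp.toLp 2 ![y 0, y 1, c']))) (R (EuclideanSpace.single 2 1)) ^ 2 /
          Real.sqrt (inner ℝ (Literature.Analysis.FluidPDE.curl v (R (WithLp.toLp 2 ![y 0, y 1, c'])))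
            (R (EuclideanSpace.single 2 1)) ^ 2 + ε ^ 2)) +
      ∫ x in {x : EuclideanSpace ℝ (Fin 3) | inner ℝ x (R (EuclideanSpace.single 2 1)) ∈ Set.uIcc c c'},
        ε ^ 2 / Real.sqrt (inner ℝ (Literature.Analysis.FluidPDE.curl v x) (R (EuclideanSpace.single 2 1)) ^ 2
          + ε ^ 2) ^ 3 *
        |fderiv ℝ (fun z => inner ℝ (Literature.Analysis.FluidPDE.curl v z) (R (EuclideanSpace.single 2 1))) x
          (Literature.Analysis.FluidPDE.curl v x)| := by
  intro ε hε R c c' v hv hC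
  obtain ⟨C, hC⟩ := hC
  set n : EuclideanSpace ℝ (Fin 3) := R (EuclideanSpace.single 2 1) with hn_def
  -- bulk integrability of the signed and unsigned apex densities
  have hQ := apexLipschitz_integrable_density hε n hv hC
  have cΩ : Continuous (curl v) := (SlicedKelvinPlanarFluxAPriori.contDiff_curl hv).continuous
  have cDf : Continuous (fderiv ℝ (fun z => ⟪curl v z, n⟫)) :=
    (contDiff_inner_curl hv n).continuous_fderiv (by simp)
  have cG : Continuous (fun z => Real.sqrt (⟪curl v z, n⟫ ^ 2 + ε ^ 2)) :=
    (contDiff_sqrtReg_inner_curl hv hε n).continuous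
  have cF2 : Continuous (fun z => ε ^ 2 / Real.sqrt (⟪curl v z, n⟫ ^ 2 + ε ^ 2) ^ 3) :=
    continuous_const.div (cG.pow 3) fun x => by positivity
  have cP : Continuous (fun x => ε ^ 2 / Real.sqrt (⟪curl v x, n⟫ ^ 2 + ε ^ 2) ^ 3 *
      fderiv ℝ (fun z => ⟪curl v z, n⟫) x (curl v x)) := cF2.mul (cDf.clm_apply cΩ)
  have habs : ∀ x, ‖ε ^ 2 / Real.sqrt (⟪curl v x, n⟫ ^ 2 + ε ^ 2) ^ 3 *
      fderiv ℝ (fun z => ⟪curl v z, n⟫) x (curl v x)‖ =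
      ε ^ 2 / Real.sqrt (⟪curl v x, n⟫ ^ 2 + ε ^ 2) ^ 3 *
        |fderiv ℝ (fun z => ⟪curl v z, n⟫) x (curl v x)| := fun x => by
    rw [Real.norm_eq_abs, abs_mul, abs_of_nonneg (sq_div_sqrt_cube_nonneg _ _)]
  have hP : Integrable (fun x => ε ^ 2 / Real.sqrt (⟪curl v x, n⟫ ^ 2 + ε ^ 2) ^ 3 *
      fderiv ℝ (fun z => ⟪curl v z, n⟫) x (curl v x)) :=
    hQ.mono' cP.aestronglyMeasurable (ae_of_all _ fun x => (habs x).le)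
  -- the slab integral is the height integral of the plane integrals
  rw [apexLipschitz_setIntegral_slab_eq R _ hQ c c']
  -- the one-sided fundamental-theorem estimate for `g(s) = ∫_{Π_s} f²/√(f²+ε²)`
  refine apexLipschitz_le_add_setIntegral_of_hasDerivAt
    (fun s => apexLipschitz_hasDerivAt_planeIntegral ε hε R v C hv hC s)
    (apexLipschitz_integrable_planeIntegral R hP) (apexLipschitz_integrable_planeIntegral R hQ)
    (fun s => ?_) c c'
  rw [← Real.norm_eq_abs]
  refine (norm_integral_le_integral_norm _).trans (le_of_eq ?_)
  exact integral_congr_ae (ae_of_all _ fun y => habs _)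

end Summit.NavierStokesRegularity.NavierStokesRegularity.Theorems.SlicedKelvinPlanarFluxAPriori

end
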